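import Summits.Ventures.HodgeRepro2.T5FinitePlaceQuadratic

/-!
# The decomposition group acts on the completion: an automorphism fixing `w` extends to `L_w`, and a
`c`-fixed place of a quadratic extension is NON-split (cell pub-hodge-repro2, seat p3)

Tier-5 N2 support, §N2.9.2 of route/T5-N2-route-3.md («completions») at the finite places, continued from files
115–116, towards the GLOBAL half of «`θ` a `v`-adic square ⟺ `v` splits». For number fields `K ⊆ L`, a
`K`-automorphism `σ` of `L` and a finite place `w` of `L` with `σ • w = w` (`σ` in the decomposition group of `w`):
`w(σ x) = w(x)` (`intValuation_smul`, `valuation_smul`), `σ` is uniformly continuous for the `w`-adic uniformity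
(`uniformContinuous_withValMap`) and extends to a continuous ring automorphism `decompAut σ : L_w →+* L_w`
(`decompAut_coe`, `continuous_decompAut`) which fixes `Kᵥ` pointwise (`decompAut_algebraMap_left`, by density).
CONSEQUENCE for a quadratic `E = F(s)`, `s² = θ`, `s ≠ 0`, with `c s = −s`: **if `c • w = w` then `θ` is NOT a
`v`-adic square** (`not_isSquare_of_smul_eq`), so `[E_w : F_v] = 2` (`finrank_eq_two_of_smul_eq`) — on a field
`E_w = F_v` the extension of `c` would be the identity, but it sends `√θ` to `−√θ ≠ √θ`. With file 97's
«`c • w = w` ⟺ exactly one prime of `E` above `v`» this reads: ONE prime above `v` ⟹ `[E_w : F_v] = 2`.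
The converse (two primes above `v` ⟹ `E_w = F_v`) is the global count, NOT here.
Mathlib + files 115–116 only. No display; no device. §8(d): uses an L-value-free non-vanishing device: NO.
-/

namespace Summit.Ventures.HodgeRepro2.T5FinitePlaceDecompAut

open IsDedekindDomain IsDedekindDomain.HeightOneSpectrum NumberField Module UniformSpace WithZero
open scoped Summit.Ventures.HodgeRepro2.T5FinitePlaceLiesOver Pointwise
open Summit.Ventures.HodgeRepro2.T5FinitePlaceLiesOver Summit.Ventures.HodgeRepro2.T5FinitePlaceQuadratic

section Threshold

/-- Two elements `≤ 1` of `ℤᵐ⁰` with the same thresholds `≤ exp (−n)` are equal. -/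
theorem eq_of_forall_le_exp_neg_iff {a b : ℤᵐ⁰} (ha : a ≤ 1) (hb : b ≤ 1)
    (h : ∀ n : ℕ, a ≤ exp (-(n : ℤ)) ↔ b ≤ exp (-(n : ℤ))) : a = b := by
  have key : ∀ {a b : ℤᵐ⁰}, a ≤ 1 → b ≤ 1 → (∀ n : ℕ, a ≤ exp (-(n : ℤ)) ↔ b ≤ exp (-(n : ℤ))) → a ≤ b := by
    intro a b ha hb h
    rcases eq_or_ne b 0 with hb0 | hb0
    · rw [hb0]
      by_contra ha0
      have ha0' : a ≠ 0 := fun h0 => ha0 (le_of_eq h0)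
      have hlog : ∀ n : ℕ, log a ≤ -(n : ℤ) := fun n =>
        (log_le_iff_le_exp ha0').mpr ((h n).mpr (by rw [hb0]; exact zero_le))
      have := hlog ((-log a).toNat + 1)
      have h2 : -log a ≤ ((-log a).toNat : ℤ) := Int.self_le_toNat _
      push_cast at this
      omega
    · have hlogb : log b ≤ 0 := by
        rw [log_le_iff_le_exp hb0]
        simpa using hb
      have hn : exp (-(((-log b).toNat : ℕ) : ℤ)) = b := by
        rw [Int.toNat_of_nonneg (by omega), neg_neg, exp_log hb0]
      exact (h _).mpr hn.ge |>.trans hn.le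
  exact le_antisymm (key ha hb h) (key hb ha fun n => (h n).symm)

end Threshold

section General

variable {K L : Type*} [Field K] [Field L] [NumberField L] [Algebra K L]
variable (w : HeightOneSpectrum (𝓞 L)) (σ : L ≃ₐ[K] L) (hw : σ • w.asIdeal = w.asIdeal)

omit [NumberField L] in
include hw in
/-- `σ • r ∈ wⁿ ↔ r ∈ wⁿ` when `σ • w = w`. -/
theorem smul_mem_pow_iff (r : 𝓞 L) (n : ℕ) : σ • r ∈ w.asIdeal ^ n ↔ r ∈ w.asIdeal ^ n := by
  conv_lhs => rw [← hw, Ideal.pointwise_smul_def, ← Ideal.map_pow, ← Ideal.pointwise_smul_def]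
  exact Ideal.smul_mem_pointwise_smul_iff

include hw in
/-- **`w(σ r) = w(r)`** on the ring of integers when `σ • w = w`. -/
theorem intValuation_smul (r : 𝓞 L) : w.intValuation (σ • r) = w.intValuation r :=
  eq_of_forall_le_exp_neg_iff (w.intValuation_le_one _) (w.intValuation_le_one _) fun n => by
    rw [intValuation_le_pow_iff_mem, intValuation_le_pow_iff_mem, smul_mem_pow_iff w σ hw]

include hw in
/-- **`w(σ x) = w(x)`** on `L` when `σ • w = w`. -/
theorem valuation_smul (x : L) : w.valuation L (σ x) = w.valuation L x := by
  obtain ⟨a, b, hb, rfl⟩ := IsFractionRing.div_surjective (A := 𝓞 L) x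
  have ha : σ (algebraMap (𝓞 L) L a) = algebraMap (𝓞 L) L (σ • a) := rfl
  have hb' : σ (algebraMap (𝓞 L) L b) = algebraMap (𝓞 L) L (σ • b) := rfl
  rw [map_div₀, ha, hb', map_div₀, map_div₀, valuation_of_algebraMap, valuation_of_algebraMap,
    valuation_of_algebraMap, valuation_of_algebraMap, intValuation_smul w σ hw, intValuation_smul w σ hw]

/-- `σ` as a ring endomorphism of `WithVal (w.valuation L)`. -/
noncomputable def withValMap : WithVal (w.valuation L) →+* WithVal (w.valuation L) :=
  WithVal.map _ _ σ.toRingHom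

include hw in
/-- `σ` preserves the `w`-adic valuation on `WithVal`. -/
theorem valued_withValMap (x : WithVal (w.valuation L)) : Valued.v (withValMap w σ x) = Valued.v x := by
  show w.valuation L (σ x.ofVal) = w.valuation L x.ofVal
  exact valuation_smul w σ hw x.ofVal

include hw in
/-- **`σ` is uniformly continuous for the `w`-adic uniformity** when `σ • w = w`. -/
theorem uniformContinuous_withValMap : UniformContinuous (withValMap w σ) := by
  refine uniformContinuous_of_continuousAt_zero (withValMap w σ) ?_
  rw [ContinuousAt, map_zero, Filter.tendsto_def]
  intro s hs
  obtain ⟨γ, hγ⟩ := Valued.mem_nhds_zero.mp hs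
  refine Valued.mem_nhds_zero.mpr ⟨γ, fun x hx => hγ ?_⟩
  simp only [Set.mem_setOf_eq, Valuation.restrict_lt_iff_lt_embedding] at hx ⊢
  rwa [valued_withValMap w σ hw]

/-- **The extension of `σ` to the completion `L_w`** (for `σ • w = w`). -/
noncomputable def decompAut : w.adicCompletion L →+* w.adicCompletion L :=
  ((adicCompletion.equiv L w).symm.toRingHom.comp
    (Completion.mapRingHom (withValMap w σ) (uniformContinuous_withValMap w σ hw).continuous)).comp
    (adicCompletion.equiv L w).toRingHom

/-- `decompAut σ` restricted to `L` is `σ`. -/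
theorem decompAut_coe (x : L) : decompAut w σ hw (x : w.adicCompletion L) = (σ x : w.adicCompletion L) := by
  apply adicCompletion.ext
  exact Completion.mapRingHom_coe _ _

/-- `decompAut σ` is continuous. -/
theorem continuous_decompAut : Continuous (decompAut w σ hw) :=
  (adicCompletion.continuous_ofCompletion L w).comp <|
    Completion.continuous_map.comp (adicCompletion.continuous_toCompletion L w)

variable [NumberField K] (v : HeightOneSpectrum (𝓞 K)) [w.asIdeal.LiesOver v.asIdeal]

/-- **`decompAut σ` fixes `Kᵥ` pointwise** (it fixes `K`, and `K` is dense in `Kᵥ`). -/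
theorem decompAut_algebraMap_left (a : v.adicCompletion K) :
    decompAut w σ hw (algebraMap (v.adicCompletion K) (w.adicCompletion L) a) =
      algebraMap (v.adicCompletion K) (w.adicCompletion L) a := by
  have hd : DenseRange (algebraMap K (v.adicCompletion K)) := denseRange_algebraMap (K := K) (v := v)
  have h1 : Continuous fun y : v.adicCompletion K =>
      decompAut w σ hw (algebraMap (v.adicCompletion K) (w.adicCompletion L) y) :=
    (continuous_decompAut w σ hw).comp (continuous_completionMap K L v w)
  have h2 : Continuous fun y : v.adicCompletion K => algebraMap (v.adicCompletion K) (w.adicCompletion L) y :=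
    continuous_completionMap K L v w
  refine congrFun (hd.equalizer h1 h2 (funext fun k => ?_)) a
  simp only [Function.comp_apply]
  rw [show algebraMap K (v.adicCompletion K) k = (k : v.adicCompletion K) from rfl, algebraMap_eq_completionMap,
    completionMap_coe, decompAut_coe, AlgEquiv.commutes]

end General

section Quadratic

variable {F E : Type*} [Field F] [NumberField F] [Field E] [NumberField E] [Algebra F E]
variable (v : HeightOneSpectrum (𝓞 F)) (w : HeightOneSpectrum (𝓞 E)) [w.asIdeal.LiesOver v.asIdeal]
variable {s : E} {θ : F}

/-- **A `c`-fixed place is non-split:** if `c • w = w`, `c s = −s` and `s ≠ 0`, then `θ = s²` is NOT a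
`v`-adic square (on `E_w = F_v` the extension of `c` would be the identity, but `c √θ = −√θ`). -/
theorem not_isSquare_of_smul_eq (hs : s ^ 2 = algebraMap F E θ) (hspan : Submodule.span F {(1 : E), s} = ⊤)
    (hs0 : s ≠ 0) (c : E ≃ₐ[F] E) (hc : c s = -s) (hw : c • w.asIdeal = w.asIdeal) :
    ¬ IsSquare (algebraMap F (v.adicCompletion F) θ) := by
  intro hsq
  have h1 := (finrank_eq_one_iff_isSquare v w hs hspan).mpr hsq
  obtain ⟨-, hsurj⟩ := Algebra.finrank_eq_one_iff_bijective_algebraMap.mp h1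
  obtain ⟨a, ha⟩ := hsurj (algebraMap E (w.adicCompletion E) s)
  have h2 : decompAut w c hw (algebraMap E (w.adicCompletion E) s) = algebraMap E (w.adicCompletion E) s := by
    rw [← ha, decompAut_algebraMap_left w c hw v]
  have h3 : decompAut w c hw (algebraMap E (w.adicCompletion E) s) = algebraMap E (w.adicCompletion E) (-s) := by
    rw [← hc]
    exact decompAut_coe w c hw s
  have h4 : s = -s := (algebraMap E (w.adicCompletion E)).injective (h2.symm.trans h3)
  have h5 : (2 : E) * s = 0 := by rw [two_mul, add_eq_zero_iff_eq_neg]; exact h4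
  rcases mul_eq_zero.mp h5 with h6 | h6
  · exact two_ne_zero h6
  · exact hs0 h6

/-- **A `c`-fixed place has local degree `2`.** -/
theorem finrank_eq_two_of_smul_eq (hs : s ^ 2 = algebraMap F E θ) (hspan : Submodule.span F {(1 : E), s} = ⊤)
    (hs0 : s ≠ 0) (c : E ≃ₐ[F] E) (hc : c s = -s) (hw : c • w.asIdeal = w.asIdeal) :
    finrank (v.adicCompletion F) (w.adicCompletion E) = 2 :=
  (finrank_eq_two_iff_not_isSquare v w hs hspan).mpr (not_isSquare_of_smul_eq v w hs hspan hs0 c hc hw)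

/-- **Contrapositive: at a split place `c` moves `w`.** -/
theorem smul_ne_of_isSquare (hs : s ^ 2 = algebraMap F E θ) (hspan : Submodule.span F {(1 : E), s} = ⊤)
    (hs0 : s ≠ 0) (c : E ≃ₐ[F] E) (hc : c s = -s) (hsq : IsSquare (algebraMap F (v.adicCompletion F) θ)) :
    c • w.asIdeal ≠ w.asIdeal :=
  fun hw => not_isSquare_of_smul_eq v w hs hspan hs0 c hc hw hsq

end Quadratic

end Summit.Ventures.HodgeRepro2.T5FinitePlaceDecompAut
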